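import Summits.QuantumFields.YangMills.Theorems.BalabanLadderIRDefectSquaringOneBox
import Literature.Analysis.ODE.OneSidedComparison
import HarnessLib

/-!
# Aspect-ratio bootstrap, part 2: the cold defect SQUARES under spatial extension (abstract, sorry-free)

Line `aspect-bootstrap` on crux `BalabanLadder.IR` (stmt-QuantumFields-19354, rung R2c; cell ym-ir, seat ym-ir-idea-6 g2,
LINE 3; skeleton `Cruxes/IR/Lines/aspect_bootstrap.lean` §1c, landed verbatim as a helper `--supports` the crux; critic
verdicts crit-1 2026-08-28T01:34Z PASS, crit-2 01:38Z PASS).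

HONEST FRAMING.  Nothing here proves the Yang–Mills mass gap (Clay), the lattice gap, or `BalabanLadder.IR`; R4
(`BalabanUVStability4`) closes only the conditional finite-𝕋⁴ rung `BalabanLadder.UV`.  This file is a KERNEL THEOREM about
EVERY family `Z : ℕ⁴ → ℝ` that is [Sym] axis-symmetric (`IsAxisSymmetric`), [TM] trace-positive in the last slot for all
spatial boxes with sides `≥ 2` (`IsTracePositive`, via `HasSpectralDatum` of part 1) and [Vol] volume-bounded
(`HasVolumeBounds`: `e^{−A·vol} ≤ Z ≤ 1`).  For such a family the cold period-doubling defect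
`boxDefect Z L = 1 − Z(L,L,L,2⌊L/4⌋)/Z(L,L,L,⌊L/4⌋)²` SQUARES under spatial extension `L ↦ L' ∈ [2L, 4L]`, `L ≥ 8`, with the
universal (β-free, model-free) constant `squaringConst = 2·432²·e^{432}` (`defectSquaring`).  Applied to Wilson's anisotropic
four-torus partition function this is the load `R = ColdPurityBridge.ColdDoublingRecursionSC` of lines `floor-handshake` /
`doubling-bridge` (census B15 «missing bootstrap»), modulo the three model facts — companion Theorems files.  It carries NO
Yang–Mills difficulty (it holds for every reflection-positive isotropic lattice model, `U(1)` included); the weight of those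
lines stays in the exit `H`/`E` and the residual `N`.  The aspect-1 defect of route `DoublingDefect` (item 17754, `t = L`) is
NOT covered: the closure step needs aspect `L : t > 2 : 1`.

THE MECHANISM («aspect-ratio bootstrap»).  `φ(B) = log λ₀(B)`, `x_τ(B) = Σ_{i≠0}(λᵢ/λ₀)^τ`, `Y_τ(B) = log(1 + x_τ(B))`:
 (1) `extension_step` — side extension read in the transposed channel (`L log Z(L',b₁,b₂,τ) ≤ L' log Z(L,b₁,b₂,τ)`,
     ℓᵖ-monotonicity of the spectrum of the box `(τ,b₁,b₂)`): `Y_τ(L',b₁,b₂) ≤ (L'/L) Y_τ(L,b₁,b₂) + τ s` with the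
     CASIMIR SLOPE `s = (L'/L) φ(L,b₁,b₂) − φ(L',b₁,b₂)`;
 (2) `slope_bound` — the slope is a SLAB-PRESSURE quantity: `τ s ≤ (L'/L) Y_t(τ,b₁,b₂) + Y_2(L',b₁,b₂)` (`t ≤ L`);
 (3) `extension_le` — CLOSURE on the dyadic tower `2^j L`: with `a_j = Y_t(2^j L,b₁,b₂)/(2^j L)`, `M = sup a ≤ a₀ + θM`,
     `θ = 2t/L ≤ 1/2`, so `Y_t(L',b₁,b₂) ≤ (3/2)(L'/L) Y_t(L,b₁,b₂)` ([Vol] only makes `sup a` exist);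
 (4) three side extensions, moving the short side to slot 0 by [Sym]: `Y_t((L')³) ≤ (3L'/2L)³ Y_t(L³) ≤ 216 Y_t(L³)`;
 (5) time doubling squares (`exc_two_mul_le_sq`, `defect_facts`): `δ(L') ≤ 2(e^{432 δ(L)} − 1)² ≤ squaringConst · δ(L)²`.
Cheapest falsifier run before typing (ideator, exact 2D Ising torus): all four inequalities of the chain hold in 63/63 rows,
observed `δ(2L)/δ(L)² ≤ 1.1`.

References: M. Lüscher, Commun. Math. Phys. 54 (1977) 283; K. Osterwalder, E. Seiler, Ann. Phys. 110 (1978) 440 §§2–3;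
I. Montvay, G. Münster, *Quantum Fields on a Lattice* (1994) §3.2.6; card `Cruxes/IR/MECHANISM-ym-ir-idea-6.md`.
-/

noncomputable section

open scoped BigOperators Topology
open Filter

namespace Summit.QuantumFields.YangMills.Cruxes.IR.AspectBootstrap
/-! ## §1c The bootstrap over an axis-symmetric trace-positive family -/

/-- [Sym] The three transpositions of the arguments of `Z : ℕ⁴ → ℝ` used by the bootstrap: `(0 3)` (read the first
side as Euclidean time), `(0 1)` and `(0 2)` (move the short spatial side to slot 0).  They generate `S₄`. -/
def IsAxisSymmetric (Z : ℕ → ℕ → ℕ → ℕ → ℝ) : Prop :=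
  ∀ a b c d : ℕ, Z a b c d = Z d b c a ∧ Z a b c d = Z b a c d ∧ Z a b c d = Z c b a d

/-- [TM-aniso] Every spatial box `(b₁,b₂,b₃)` with sides `≥ 2` has a spectral datum for the time direction (slot 3). -/
def IsTracePositive (Z : ℕ → ℕ → ℕ → ℕ → ℝ) : Prop :=
  ∀ b₁ b₂ b₃ : ℕ, 2 ≤ b₁ → 2 ≤ b₂ → 2 ≤ b₃ → HasSpectralDatum (Z b₁ b₂ b₃)

/-- [Vol] Stability bounds `e^{−A·n₀n₁n₂n₃} ≤ Z ≤ 1` (sides `≥ 2`; for Wilson's action at `β ≥ 0`: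
`0 ≤ n − Re tr ρ(U_p) ≤ 2n` on each of the `6·n₀n₁n₂n₃` plaquettes, `A = 12 n β`). -/
def HasVolumeBounds (Z : ℕ → ℕ → ℕ → ℕ → ℝ) : Prop :=
  ∃ A : ℝ, ∀ a b c d : ℕ, 2 ≤ a → 2 ≤ b → 2 ≤ c → 2 ≤ d →
    Real.exp (-(A * ((a * b * c * d : ℕ) : ℝ))) ≤ Z a b c d ∧ Z a b c d ≤ 1

/-- The cold defect of an abstract family: `1 − Z(L,L,L,2⌊L/4⌋)/Z(L,L,L,⌊L/4⌋)²` (`coldDefect` is this, by `rfl`). -/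
def boxDefect (Z : ℕ → ℕ → ℕ → ℕ → ℝ) (L : ℕ) : ℝ :=
  1 - Z L L L (2 * (L / 4)) / Z L L L (L / 4) ^ 2

/-- The universal (β-free, model-free) squaring constant `2·432²·e^{432}` produced by the bootstrap (not optimised;
the exact 2D-Ising data show `δ(2L)/δ(L)² ≤ 1.1`). -/
def squaringConst : ℝ := 2 * 432 ^ 2 * Real.exp 432

section Family

variable {Z : ℕ → ℕ → ℕ → ℕ → ℝ}

/-- **Casimir slope ≤ slab pressure** (step (2)): for `2 ≤ τ`, `2 ≤ c ≤ n ≤ n'`,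
`τ ((n'/n) φ(n,b₁,b₂) − φ(n',b₁,b₂)) ≤ (n'/n) Y_c(τ,b₁,b₂) + Y_2(n',b₁,b₂)`. -/
theorem slope_bound (hS : IsAxisSymmetric Z) (hT : IsTracePositive Z) {b₁ b₂ τ c n n' : ℕ}
    (hb₁ : 2 ≤ b₁) (hb₂ : 2 ≤ b₂) (hτ : 2 ≤ τ) (hc : 2 ≤ c) (hcn : c ≤ n) (hnn' : n ≤ n') :
    (τ : ℝ) * (((n' : ℝ) / n) * phi (Z n b₁ b₂) - phi (Z n' b₁ b₂)) ≤
      ((n' : ℝ) / n) * Yfun (Z τ b₁ b₂) c + Yfun (Z n' b₁ b₂) 2 := by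
  obtain ⟨kτ, rfl⟩ : ∃ kτ, τ = kτ + 2 := ⟨τ - 2, by omega⟩
  obtain ⟨kc, rfl⟩ : ∃ kc, c = kc + 2 := ⟨c - 2, by omega⟩
  obtain ⟨kn, rfl⟩ : ∃ kn, n = kn + 2 := ⟨n - 2, by omega⟩
  obtain ⟨kn', rfl⟩ : ∃ kn', n' = kn' + 2 := ⟨n' - 2, by omega⟩
  have hdn : HasSpectralDatum (Z (kn + 2) b₁ b₂) := hT _ _ _ (by omega) hb₁ hb₂
  have hdn' : HasSpectralDatum (Z (kn' + 2) b₁ b₂) := hT _ _ _ (by omega) hb₁ hb₂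
  have hdτ : HasSpectralDatum (Z (kτ + 2) b₁ b₂) := hT _ _ _ (by omega) hb₁ hb₂
  have A1 := mul_phi_le_log hdn kτ
  have A2 := log_le_mul_phi_add hdn' kτ
  have A3 : Z (kn + 2) b₁ b₂ (kτ + 2) = Z (kτ + 2) b₁ b₂ (kn + 2) := (hS _ _ _ _).1
  have A3' : Z (kn' + 2) b₁ b₂ (kτ + 2) = Z (kτ + 2) b₁ b₂ (kn' + 2) := (hS _ _ _ _).1
  have hnpos : (0 : ℝ) < ((kn + 2 : ℕ) : ℝ) := by positivity
  have hq : 0 ≤ ((kn' + 2 : ℕ) : ℝ) / ((kn + 2 : ℕ) : ℝ) := by positivity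
  have hqn : ((kn' + 2 : ℕ) : ℝ) / ((kn + 2 : ℕ) : ℝ) * ((kn + 2 : ℕ) : ℝ) = ((kn' + 2 : ℕ) : ℝ) :=
    div_mul_cancel₀ _ hnpos.ne'
  have A4 := termwise hdτ (show kc ≤ kn by omega) _ hq hqn
  rw [← A3, ← A3'] at A4
  have A1' := mul_le_mul_of_nonneg_left A1 hq
  -- assemble
  have e : ((kτ + 2 : ℕ) : ℝ) * (((kn' + 2 : ℕ) : ℝ) / ((kn + 2 : ℕ) : ℝ) * phi (Z (kn + 2) b₁ b₂)) =
      ((kn' + 2 : ℕ) : ℝ) / ((kn + 2 : ℕ) : ℝ) * (((kτ + 2 : ℕ) : ℝ) * phi (Z (kn + 2) b₁ b₂)) := by ring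
  push_cast at e A1' A2 A4 ⊢
  nlinarith [e, A1', A2, A4]

/-- **Side extension in the transposed channel** (step (1)): for `0 < c`, `2 ≤ n ≤ n'`,
`Y_c(n',b₁,b₂) ≤ (n'/n) Y_c(n,b₁,b₂) + c ((n'/n) φ(n,b₁,b₂) − φ(n',b₁,b₂))`. -/
theorem extension_step (hS : IsAxisSymmetric Z) (hT : IsTracePositive Z) {b₁ b₂ c n n' : ℕ}
    (hb₁ : 2 ≤ b₁) (hb₂ : 2 ≤ b₂) (hc : 2 ≤ c) (hn : 2 ≤ n) (hnn' : n ≤ n') :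
    Yfun (Z n' b₁ b₂) c ≤ ((n' : ℝ) / n) * Yfun (Z n b₁ b₂) c +
      (c : ℝ) * (((n' : ℝ) / n) * phi (Z n b₁ b₂) - phi (Z n' b₁ b₂)) := by
  obtain ⟨kn, rfl⟩ : ∃ kn, n = kn + 2 := ⟨n - 2, by omega⟩
  obtain ⟨kn', rfl⟩ : ∃ kn', n' = kn' + 2 := ⟨n' - 2, by omega⟩
  have hw : HasSpectralDatum (Z c b₁ b₂) := hT _ _ _ hc hb₁ hb₂
  have h1 := mul_log_le hw (show kn ≤ kn' by omega)
  have A3 : Z (kn + 2) b₁ b₂ c = Z c b₁ b₂ (kn + 2) := (hS _ _ _ _).1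
  have A3' : Z (kn' + 2) b₁ b₂ c = Z c b₁ b₂ (kn' + 2) := (hS _ _ _ _).1
  rw [← A3, ← A3'] at h1
  have hnpos : (0 : ℝ) < ((kn + 2 : ℕ) : ℝ) := by positivity
  have key : Real.log (Z (kn' + 2) b₁ b₂ c) ≤
      ((kn' + 2 : ℕ) : ℝ) / ((kn + 2 : ℕ) : ℝ) * Real.log (Z (kn + 2) b₁ b₂ c) := by
    rw [div_mul_eq_mul_div, le_div_iff₀ hnpos]
    linarith
  unfold Yfun
  have e : ((kn' + 2 : ℕ) : ℝ) / ((kn + 2 : ℕ) : ℝ) * (Real.log (Z (kn + 2) b₁ b₂ c) - (c : ℝ) * phi (Z (kn + 2) b₁ b₂)) +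
      (c : ℝ) * (((kn' + 2 : ℕ) : ℝ) / ((kn + 2 : ℕ) : ℝ) * phi (Z (kn + 2) b₁ b₂) - phi (Z (kn' + 2) b₁ b₂)) =
      ((kn' + 2 : ℕ) : ℝ) / ((kn + 2 : ℕ) : ℝ) * Real.log (Z (kn + 2) b₁ b₂ c) - (c : ℝ) * phi (Z (kn' + 2) b₁ b₂) := by
    ring
  rw [e]
  linarith

/-- **The closed extension inequality** (steps (1)–(3)): for `L ≥ 8`, `t = ⌊L/4⌋`, `L ≤ L'` and any cross-section
`(b₁,b₂)`: `Y_t(L',b₁,b₂) ≤ (3/2)(L'/L) Y_t(L,b₁,b₂)` — the Casimir slope is bounded by the slab pressure of the SAME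
cross-section, and the slab-pressure tower closes on the box of length `L` itself because `2t/L ≤ 1/2 < 1`. -/
theorem extension_le (hS : IsAxisSymmetric Z) (hT : IsTracePositive Z) (hV : HasVolumeBounds Z)
    {b₁ b₂ L L' : ℕ} (hb₁ : 2 ≤ b₁) (hb₂ : 2 ≤ b₂) (hL : 8 ≤ L) (hLL' : L ≤ L') :
    Yfun (Z L' b₁ b₂) (L / 4) ≤ 3 / 2 * ((L' : ℝ) / L) * Yfun (Z L b₁ b₂) (L / 4) := by
  obtain ⟨k, hk⟩ : ∃ k, L / 4 = k + 2 := ⟨L / 4 - 2, by omega⟩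
  rw [hk]
  obtain ⟨A, hA⟩ := hV
  have hLpos : 0 < L := by omega
  have hLr : (0 : ℝ) < L := by exact_mod_cast hLpos
  have hL0 : (L : ℝ) ≠ 0 := hLr.ne'
  have ht4 : 4 * (k + 2) ≤ L := by omega
  have hθ : ((k + 2 : ℕ) : ℝ) / L ≤ 1 / 4 := by
    rw [div_le_iff₀ hLr]
    have : ((4 * (k + 2) : ℕ) : ℝ) ≤ L := by exact_mod_cast ht4
    push_cast at this ⊢
    linarith
  -- the dyadic tower `D_i = 2^i L`
  have hD : ∀ i : ℕ, 0 < 2 ^ i * L := fun i => by positivity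
  have hD2 : ∀ i : ℕ, 2 ≤ 2 ^ i * L := fun i =>
    le_trans (by omega) (Nat.mul_le_mul_right L (Nat.one_le_two_pow))
  have hDc : ∀ i : ℕ, k + 2 ≤ 2 ^ i * L := fun i =>
    le_trans (by omega) (Nat.mul_le_mul_right L (Nat.one_le_two_pow))
  have hDD : ∀ j : ℕ, 2 ^ j * L ≤ 2 ^ (j + 1) * L := fun j =>
    Nat.mul_le_mul_right L (Nat.pow_le_pow_right (by norm_num) (by omega))
  have hDr : ∀ i : ℕ, ((2 ^ i * L : ℕ) : ℝ) = (2 : ℝ) ^ i * L := fun i => by push_cast; ring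
  have hDr0 : ∀ i : ℕ, (0 : ℝ) < (2 : ℝ) ^ i * L := fun i => by positivity
  have hr : ∀ j : ℕ, ((2 ^ (j + 1) * L : ℕ) : ℝ) / ((2 ^ j * L : ℕ) : ℝ) = 2 := fun j => by
    rw [hDr, hDr, pow_succ]
    field_simp
  set a : ℕ → ℝ := fun i => Yfun (Z (2 ^ i * L) b₁ b₂) (k + 2) / ((2 : ℝ) ^ i * L) with ha_def
  have hai : ∀ i, Yfun (Z (2 ^ i * L) b₁ b₂) (k + 2) = a i * ((2 : ℝ) ^ i * L) := fun i => by
    rw [ha_def]; dsimp only; rw [div_mul_cancel₀ _ (hDr0 i).ne']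
  -- (P3) a priori bounds
  have ha0 : ∀ i, 0 ≤ a i := fun i =>
    div_nonneg (Yfun_nonneg (hT _ _ _ (hD2 i) hb₁ hb₂) k) (hDr0 i).le
  have hphi_ge : ∀ D : ℕ, 2 ≤ D → -(A * D * b₁ * b₂) ≤ phi (Z D b₁ b₂) := fun D hDpos => by
    have hd := hT D b₁ b₂ hDpos hb₁ hb₂
    refine phi_ge_of_lower hd (A * D * b₁ * b₂) fun m => ?_
    have h1 := (hA D b₁ b₂ (m + 2) hDpos hb₁ hb₂ (by omega)).1
    have h2 := Real.log_le_log (Real.exp_pos _) h1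
    rw [Real.log_exp] at h2
    have e : (A * ((D * b₁ * b₂ * (m + 2) : ℕ) : ℝ)) = A * D * b₁ * b₂ * ((m + 2 : ℕ) : ℝ) := by
      push_cast; ring
    linarith
  have haA : ∀ i, a i ≤ 2 * A * b₁ * b₂ := fun i => by
    have hd := hT _ _ _ (hD2 i) hb₁ hb₂
    have h1 : Yfun (Z (2 ^ i * L) b₁ b₂) (k + 2) ≤ Yfun (Z (2 ^ i * L) b₁ b₂) (0 + 2) :=
      Yfun_antitone hd (Nat.zero_le k)
    have h2 : Real.log (Z (2 ^ i * L) b₁ b₂ 2) ≤ 0 :=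
      Real.log_nonpos (z_pos hd 0).le ((hA _ _ _ 2 (hD2 i) hb₁ hb₂ le_rfl).2)
    have h3 := hphi_ge (2 ^ i * L) (hD2 i)
    rw [hDr i] at h3
    rw [ha_def]; dsimp only
    rw [div_le_iff₀ (hDr0 i)]
    unfold Yfun at h1 ⊢
    simp only [Nat.zero_add, Nat.cast_ofNat] at h1
    nlinarith
  have hbdd : BddAbove (Set.range a) := ⟨2 * A * b₁ * b₂, by rintro _ ⟨i, rfl⟩; exact haA i⟩
  set M : ℝ := ⨆ i, a i with hM_def
  have hleM : ∀ i, a i ≤ M := fun i => le_ciSup hbdd i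
  have hM0 : 0 ≤ M := (ha0 0).trans (hleM 0)
  -- limit tool: `c + K/(2^i L) → c`
  have hlim : ∀ K c : ℝ, Tendsto (fun i : ℕ => c + K / ((2 : ℝ) ^ i * L)) atTop (𝓝 c) := fun K c => by
    have h1 : Tendsto (fun i : ℕ => ((1 : ℝ) / 2) ^ i) atTop (𝓝 0) :=
      tendsto_pow_atTop_nhds_zero_of_lt_one (by norm_num) (by norm_num)
    have h2 := (h1.const_mul (K / L)).const_add c
    simp only [mul_zero, add_zero] at h2
    refine h2.congr' (Eventually.of_forall fun i => ?_)
    rw [one_div_pow]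
    field_simp
  -- (P2) every doubling slope of the tower is ≤ 2M
  have hslope : ∀ j, 2 * phi (Z (2 ^ j * L) b₁ b₂) - phi (Z (2 ^ (j + 1) * L) b₁ b₂) ≤ 2 * M := fun j => by
    have key : ∀ i, 2 * phi (Z (2 ^ j * L) b₁ b₂) - phi (Z (2 ^ (j + 1) * L) b₁ b₂) ≤
        2 * M + Yfun (Z (2 ^ (j + 1) * L) b₁ b₂) 2 / ((2 : ℝ) ^ i * L) := fun i => by
      have h := slope_bound hS hT hb₁ hb₂ (hD2 i) (show 2 ≤ k + 2 by omega) (hDc j) (hDD j)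
      rw [hr j, hDr i, hai i] at h
      have h' := mul_le_mul_of_nonneg_right (hleM i) (hDr0 i).le
      rw [show 2 * M + Yfun (Z (2 ^ (j + 1) * L) b₁ b₂) 2 / ((2 : ℝ) ^ i * L) =
        (2 * M * ((2 : ℝ) ^ i * L) + Yfun (Z (2 ^ (j + 1) * L) b₁ b₂) 2) / ((2 : ℝ) ^ i * L) from by
          field_simp, le_div_iff₀ (hDr0 i)]
      nlinarith
    exact le_of_tendsto_of_tendsto' tendsto_const_nhds (hlim _ _) key
  -- (P1) + (P2): the slab pressures of the tower stay below `a 0 + θ M`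
  have hP1 : ∀ j, a (j + 1) ≤ a j + ((k + 2 : ℕ) : ℝ) * (2 * M) / ((2 : ℝ) ^ (j + 1) * L) := fun j => by
    have h := extension_step hS hT hb₁ hb₂ (show 2 ≤ k + 2 by omega) (hD2 j) (hDD j)
    rw [hr j, hai j, hai (j + 1)] at h
    have hs := mul_le_mul_of_nonneg_left (hslope j) (show (0 : ℝ) ≤ ((k + 2 : ℕ) : ℝ) by positivity)
    rw [show a j + ((k + 2 : ℕ) : ℝ) * (2 * M) / ((2 : ℝ) ^ (j + 1) * L) =
      (a j * ((2 : ℝ) ^ (j + 1) * L) + ((k + 2 : ℕ) : ℝ) * (2 * M)) / ((2 : ℝ) ^ (j + 1) * L) from by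
        field_simp, le_div_iff₀ (hDr0 (j + 1))]
    have e2 : (2 : ℝ) ^ (j + 1) = 2 * 2 ^ j := by ring
    rw [e2] at h ⊢
    nlinarith
  have hθM : ∀ i, a i ≤ a 0 + ((k + 2 : ℕ) : ℝ) / L * (2 * M) := by
    have main : ∀ i, a i ≤ a 0 + ((k + 2 : ℕ) : ℝ) / L * (2 * M) * (1 - 1 / (2 : ℝ) ^ i) := by
      intro i
      induction i with
      | zero => simp
      | succ i ih =>
        have h1 := hP1 i
        have h2i : (0 : ℝ) < (2 : ℝ) ^ i := by positivity
        have e : ((k + 2 : ℕ) : ℝ) * (2 * M) / ((2 : ℝ) ^ (i + 1) * L) =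
            ((k + 2 : ℕ) : ℝ) / L * (2 * M) * (1 / (2 : ℝ) ^ i - 1 / (2 : ℝ) ^ (i + 1)) := by
          rw [pow_succ]
          field_simp
          ring
        rw [e] at h1
        have e' : a 0 + ((k + 2 : ℕ) : ℝ) / L * (2 * M) * (1 - 1 / (2 : ℝ) ^ i) +
            ((k + 2 : ℕ) : ℝ) / L * (2 * M) * (1 / (2 : ℝ) ^ i - 1 / (2 : ℝ) ^ (i + 1)) =
            a 0 + ((k + 2 : ℕ) : ℝ) / L * (2 * M) * (1 - 1 / (2 : ℝ) ^ (i + 1)) := by ring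
        linarith
    intro i
    have h1 := main i
    have h2 : 0 ≤ ((k + 2 : ℕ) : ℝ) / L * (2 * M) * (1 / (2 : ℝ) ^ i) := by positivity
    nlinarith
  -- (3) CLOSURE: `M ≤ a 0 + θ M`, `θ ≤ 1/2`, hence `M ≤ 2 a 0`
  have hMle : M ≤ 2 * a 0 := by
    have h1 : M ≤ a 0 + ((k + 2 : ℕ) : ℝ) / L * (2 * M) := ciSup_le hθM
    have h2 : ((k + 2 : ℕ) : ℝ) / L * (2 * M) ≤ 1 / 4 * (2 * M) :=
      mul_le_mul_of_nonneg_right hθ (by linarith)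
    linarith
  -- the Casimir slope of `L → L'` is ≤ (L'/L) M
  have hL'pos : 0 < L' := by omega
  set q : ℝ := (L' : ℝ) / L with hq_def
  have hq0 : 0 ≤ q := by positivity
  have hsl : q * phi (Z L b₁ b₂) - phi (Z L' b₁ b₂) ≤ q * M := by
    have key : ∀ i, q * phi (Z L b₁ b₂) - phi (Z L' b₁ b₂) ≤
        q * M + Yfun (Z L' b₁ b₂) 2 / ((2 : ℝ) ^ i * L) := fun i => by
      have h := slope_bound hS hT hb₁ hb₂ (hD2 i) (show 2 ≤ k + 2 by omega) (show k + 2 ≤ L by omega) hLL'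
      rw [hDr i, hai i] at h
      have h' := mul_le_mul_of_nonneg_left (mul_le_mul_of_nonneg_right (hleM i) (hDr0 i).le) hq0
      rw [show q * M + Yfun (Z L' b₁ b₂) 2 / ((2 : ℝ) ^ i * L) =
        (q * M * ((2 : ℝ) ^ i * L) + Yfun (Z L' b₁ b₂) 2) / ((2 : ℝ) ^ i * L) from by
          field_simp, le_div_iff₀ (hDr0 i)]
      nlinarith
    exact le_of_tendsto_of_tendsto' tendsto_const_nhds (hlim _ _) key
  -- (P5) the extension inequality
  have h5 := extension_step hS hT hb₁ hb₂ (show 2 ≤ k + 2 by omega) (show 2 ≤ L by omega) hLL'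
  have ha0eq : a 0 = Yfun (Z L b₁ b₂) (k + 2) / L := by
    rw [ha_def]; simp
  have hY0 : 0 ≤ Yfun (Z L b₁ b₂) (k + 2) := Yfun_nonneg (hT L b₁ b₂ (by omega) hb₁ hb₂) k
  have h6 : ((k + 2 : ℕ) : ℝ) * (q * phi (Z L b₁ b₂) - phi (Z L' b₁ b₂)) ≤
      ((k + 2 : ℕ) : ℝ) * (q * (2 * (Yfun (Z L b₁ b₂) (k + 2) / L))) := by
    apply mul_le_mul_of_nonneg_left _ (by positivity)
    calc q * phi (Z L b₁ b₂) - phi (Z L' b₁ b₂) ≤ q * M := hsl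
      _ ≤ q * (2 * a 0) := mul_le_mul_of_nonneg_left hMle hq0
      _ = q * (2 * (Yfun (Z L b₁ b₂) (k + 2) / L)) := by rw [ha0eq]
  have h7 : ((k + 2 : ℕ) : ℝ) * (q * (2 * (Yfun (Z L b₁ b₂) (k + 2) / L))) =
      (2 * (((k + 2 : ℕ) : ℝ) / L)) * (q * Yfun (Z L b₁ b₂) (k + 2)) := by ring
  have h8 : (2 * (((k + 2 : ℕ) : ℝ) / L)) * (q * Yfun (Z L b₁ b₂) (k + 2)) ≤
      (1 / 2) * (q * Yfun (Z L b₁ b₂) (k + 2)) :=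
    mul_le_mul_of_nonneg_right (by linarith) (by positivity)
  linarith [h5, h6, h7, h8]


/-- `4 ≤ squaringConst`. -/
theorem four_le_squaringConst : 4 ≤ squaringConst := by
  unfold squaringConst
  have := Real.add_one_le_exp (432 : ℝ)
  nlinarith

/-- `0 < squaringConst`. -/
theorem squaringConst_pos : 0 < squaringConst := lt_of_lt_of_le (by norm_num) four_le_squaringConst

/-- **THE ABSTRACT ASPECT-RATIO BOOTSTRAP** (kernel-checked, sorry-free): for every axis-symmetric, trace-positive
family with volume bounds, the cold defect squares under spatial extension `L ↦ L' ∈ [2L, 4L]`, `L ≥ 8`, with the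
universal constant `squaringConst = 2·432²·e^{432}`. -/
theorem defectSquaring (Z : ℕ → ℕ → ℕ → ℕ → ℝ) (hS : IsAxisSymmetric Z) (hT : IsTracePositive Z)
    (hV : HasVolumeBounds Z) (L : ℕ) (hL : 8 ≤ L) (L' : ℕ) (h₁ : 2 * L ≤ L') (h₂ : L' ≤ 4 * L) :
    boxDefect Z L' ≤ squaringConst * boxDefect Z L ^ 2 := by
  obtain ⟨k, hk⟩ : ∃ k, L / 4 = k + 2 := ⟨L / 4 - 2, by omega⟩
  obtain ⟨k', hk'⟩ : ∃ k', L' / 4 = k' + 2 := ⟨L' / 4 - 2, by omega⟩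
  have hkk' : 2 * k + 2 ≤ k' := by omega
  have hLpos : 0 < L := by omega
  have hL'pos : 0 < L' := by omega
  have hLL' : L ≤ L' := by omega
  have hL2 : 2 ≤ L := by omega
  have hL'2 : 2 ≤ L' := by omega
  have hz : HasSpectralDatum (Z L L L) := hT L L L hL2 hL2 hL2
  have hz' : HasSpectralDatum (Z L' L' L') := hT L' L' L' hL'2 hL'2 hL'2
  simp only [boxDefect, hk, hk']
  obtain ⟨hδ0, -, -, hδx⟩ := defect_facts hz k
  obtain ⟨-, hδ'1, hδ'x, -⟩ := defect_facts hz' k'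
  have hC4 := four_le_squaringConst
  set δ : ℝ := 1 - Z L L L (2 * (k + 2)) / Z L L L (k + 2) ^ 2 with hδdef
  set δ' : ℝ := 1 - Z L' L' L' (2 * (k' + 2)) / Z L' L' L' (k' + 2) ^ 2 with hδ'def
  by_cases hhalf : 1 / 2 ≤ δ
  · have h1 : 1 / 4 ≤ δ ^ 2 := by nlinarith
    have h2 : 1 ≤ squaringConst * δ ^ 2 := by nlinarith
    linarith
  push Not at hhalf
  -- purity of the small cube: `y ≤ x_t ≤ 2δ`
  have hx : exc (Z L L L) (k + 2) ≤ 2 * δ := hδx δ hhalf.le le_rfl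
  have hy : Yfun (Z L L L) (k + 2) ≤ 2 * δ := (Yfun_le_exc hz k).trans hx
  have hy0 : 0 ≤ Yfun (Z L L L) (k + 2) := Yfun_nonneg hz k
  -- the three side extensions, moving the short side to slot 0 by [Sym]
  have hLr : (0 : ℝ) < L := by exact_mod_cast hLpos
  have hq : (L' : ℝ) / L ≤ 4 := by
    rw [div_le_iff₀ hLr]
    have : ((L' : ℕ) : ℝ) ≤ ((4 * L : ℕ) : ℝ) := by exact_mod_cast h₂
    push_cast at this
    linarith
  have hq0 : 0 ≤ (L' : ℝ) / L := by positivity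
  have e1 := extension_le hS hT hV hL2 hL2 hL hLL'
  have e2 := extension_le hS hT hV hL'2 hL2 hL hLL'
  have e3 := extension_le hS hT hV hL'2 hL'2 hL hLL'
  rw [hk] at e1 e2 e3
  have s1 : Z L' L L = Z L L' L := funext fun τ => (hS L' L L τ).2.1
  have s2 : Z L' L' L = Z L L' L' := funext fun τ => (hS L' L' L τ).2.2
  rw [s1] at e1
  rw [s2] at e2
  have hY' : Yfun (Z L' L' L') (k + 2) ≤ 216 * Yfun (Z L L L) (k + 2) := by
    set q : ℝ := (L' : ℝ) / L
    calc Yfun (Z L' L' L') (k + 2) ≤ 3 / 2 * q * Yfun (Z L L' L') (k + 2) := e3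
      _ ≤ 3 / 2 * q * (3 / 2 * q * Yfun (Z L L' L) (k + 2)) := mul_le_mul_of_nonneg_left e2 (by positivity)
      _ ≤ 3 / 2 * q * (3 / 2 * q * (3 / 2 * q * Yfun (Z L L L) (k + 2))) :=
          mul_le_mul_of_nonneg_left (mul_le_mul_of_nonneg_left e1 (by positivity)) (by positivity)
      _ = 27 / 8 * q ^ 3 * Yfun (Z L L L) (k + 2) := by ring
      _ ≤ 27 / 8 * 4 ^ 3 * Yfun (Z L L L) (k + 2) := by gcongr
      _ = 216 * Yfun (Z L L L) (k + 2) := by norm_num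
  -- time doubling squares the excess of the big cube
  have hx't : exc (Z L' L' L') (k + 2) ≤ Real.exp (432 * δ) - 1 := by
    rw [exc_eq_exp_Yfun hz' k]
    have : Yfun (Z L' L' L') (k + 2) ≤ 432 * δ := by linarith
    linarith [Real.exp_le_exp.2 this]
  have hx't0 : 0 ≤ exc (Z L' L' L') (k + 2) := exc_nonneg hz' k
  have hx'T : exc (Z L' L' L') (k' + 2) ≤ exc (Z L' L' L') (k + 2) ^ 2 :=
    calc exc (Z L' L' L') (k' + 2) ≤ exc (Z L' L' L') (2 * k + 2 + 2) := exc_antitone hz' hkk'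
      _ = exc (Z L' L' L') (2 * (k + 2)) := by ring_nf
      _ ≤ exc (Z L' L' L') (k + 2) ^ 2 := exc_two_mul_le_sq hz' k
  have hu : Real.exp (432 * δ) - 1 ≤ 432 * δ * Real.exp (432 * δ) := Literature.Analysis.ODE.exp_sub_one_le_mul_exp _
  have hu0 : 0 ≤ Real.exp (432 * δ) - 1 := by linarith [Real.add_one_le_exp (432 * δ)]
  have hmain : δ' ≤ 2 * (432 * δ * Real.exp (432 * δ)) ^ 2 :=
    calc δ' ≤ 2 * exc (Z L' L' L') (k' + 2) := hδ'x
      _ ≤ 2 * exc (Z L' L' L') (k + 2) ^ 2 := by linarith [hx'T]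
      _ ≤ 2 * (Real.exp (432 * δ) - 1) ^ 2 := by gcongr
      _ ≤ 2 * (432 * δ * Real.exp (432 * δ)) ^ 2 := by gcongr
  have hexp2 : Real.exp (432 * δ) ^ 2 ≤ Real.exp 432 := by
    rw [← Real.exp_nat_mul]
    exact Real.exp_le_exp.2 (by push_cast; linarith)
  have e5 : 2 * (432 * δ * Real.exp (432 * δ)) ^ 2 = 2 * 432 ^ 2 * δ ^ 2 * Real.exp (432 * δ) ^ 2 := by ring
  have e6 : 2 * 432 ^ 2 * δ ^ 2 * Real.exp (432 * δ) ^ 2 ≤ 2 * 432 ^ 2 * δ ^ 2 * Real.exp 432 :=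
    mul_le_mul_of_nonneg_left hexp2 (by positivity)
  unfold squaringConst
  linarith

end Family

end Summit.QuantumFields.YangMills.Cruxes.IR.AspectBootstrap

end
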